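import Summits.FinalStateConjecture.FinalStateConjecture.Theorems.ChannelsResolveTameDevelopmentsR.Negative.SubMinkowskiSettledT2
import Summits.FinalStateConjecture.FinalStateConjecture.Theorems.ChannelsResolveTameDevelopmentsR.Negative.SlabMinkowskiCharts
import HarnessLib

/-!
# The T2 orientation clause is AUTOMATIC on the flat model class — support (negative side) for the crux
# `ChannelsResolveTameDevelopmentsR` re-typed T2 (K2R ≡ Φ_T2, item `stmt-FinalStateConjecture-17430`,
# route PhotonSphereChannels): load-bearing analysis of the clauses the re-type added, part 1

The T2 re-type of the summit (p126844, 2026-08-16) added to the conclusion of the crux the clause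
`IsFutureOriented d` (semantic-vacuity audit §2.1 B: "neither `IsLateChart` nor `motion` pins a time
orientation, so chart time could run to the past"). This file shows, kernel-checked on the certifiable
model class, that the clause carries NO independent content once the region is honest:

* `deriv_pos_of_half_le_sq_deriv_of_nonneg` — the real-variable core: on `[s₁, ∞)` a function with values
  `≥ 0` and derivative of square `≥ 1/2` has POSITIVE derivative everywhere (Darboux: the derivative has
  constant sign; a negative sign drives the function below `0` in time `2·T(s₁) + 2`);
* `flatChart_eventually_isFutureDirected` — for EVERY open sub-development `η|_U` of the trivial datum
  (`SubMinkowski.subDev`; no completeness, no maximality) and EVERY hole-free final-state decomposition `d`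
  of a region `O ⊆ {x⁰ ≥ 0}` of it, in any `Cᵏ`: eventually in flat time `τ`, at every point of the flat
  slab `{x⁰ = τ} ∩ U₀` the push-forward of `∂₀` under the flat chart is future-directed for `(η|_U, ∂ₜ)`.
  Mechanism: `C⁰` slab convergence makes `W = dΨ₀(∂₀)` uniformly timelike (`η(W, W) ≤ −1/2`) on late slabs;
  along the `x⁰`-line through a slab point, bent to constant time below `τ₁`, the time coordinate of the
  image has derivative `W⁰`, `|W⁰| ≥ 1/√2`, and stays `≥ 0` because the image lies in `O ⊆ {x⁰ ≥ 0}`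
  (`IsLateChart.image_subset`); so `W⁰ > 0` by the core lemma — future-directed;
* `isFutureOriented_of_N_eq_zero` — hence `IsFutureOriented d` outright (the two hole clauses are vacuous);
* `isFutureOriented_of_exteriorOf` — in particular for every HONEST hole-free decomposition
  (`O = exteriorOf 𝒟 d.charted ⊆ J⁺(ι X) = {x⁰ ≥ 0}`, `time_nonneg_of_mem_causalFuture_range`).

So on the flat class the orientation clause is implied by honesty of `O`; together with
`SubMinkowskiSettledT2` (Φ_T2 without `IsMaximal` holds there) this closes the census of the new clauses on
the certifiable models: a refutation of Φ_T2 can only come through the ray-closure clause (C) on a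
development with a hidden region (crux dossier `Cruxes/ChannelsResolveTameDevelopmentsR/Disproof.lean` §8).
On paper the same argument runs in any globally hyperbolic development (a past-directed chart-time line
would be a past-directed timelike curve of infinite length inside `J⁺(Σ)`, excluded by achronality of the
Cauchy surface) and for hole charts along `t*`-lines at a large Kerr–Schild radius
(`kerr_bilin_axisPoint_le`); hole charts are absent from flat developments on paper (curvature), in Lean
only the slab case is settled (`slab_no_holeChart`), whence the hypothesis `d.N = 0` here.

All results proved; no named facts; axioms `propext`, `Classical.choice`, `Quot.sound`.

## References

* M. Dafermos, G. Holzegel, I. Rodnianski, M. Taylor, arXiv:2104.08222, §1 (late charts, deviation).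
* M. Dafermos, I. Rodnianski, arXiv:0811.0354, §5.1 (`∇t*` timelike; orientation of Kerr–Schild time).
* B. O'Neill, *Semi-Riemannian geometry* (1983), Ch. 5, p. 145 (timecones); Ch. 14, p. 402, Lemma 14.29.
-/

noncomputable section

open Bundle Set Function Filter TopologicalSpace Topology
open scoped Manifold ContDiff Topology ENNReal

set_option linter.dupNamespace false
-- operator norm on `E4 →L[ℝ] E4 →L[ℝ] ℝ` (values of the deviation), as in `SlabMinkowskiCharts`
set_option maxSynthPendingDepth 3

namespace Summit.FinalStateConjecture.FinalStateConjecture.Theorems.ChannelsResolveTameDevelopmentsR.SubMinkowski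

open Literature.Geometry.Lorentzian Literature.Geometry.Lorentzian.Minkowski
open Summit.FinalStateConjecture.FinalStateConjecture.Theorems.ChannelsResolveTameDevelopmentsR.Negative
  (half_le_sq_apply_zero_of_bilin_le velocity_eq_deriv)

/-! ### The real-variable core -/

/-- **Core (real analysis).** On `[s₁, ∞)`: if `T ≥ 0` and `T'² ≥ 1/2` everywhere, then `T' > 0`
everywhere. The derivative never vanishes, so it has constant sign (Darboux); were it negative, it would be
`≤ -1/√2 < -1/2` and `T` would drop below `0` on `[s₁, s₁ + 2T(s₁) + 2]`. -/
theorem deriv_pos_of_half_le_sq_deriv_of_nonneg {T T' : ℝ → ℝ} {s₁ : ℝ}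
    (hT : ∀ s, s₁ ≤ s → HasDerivAt T (T' s) s) (hT' : ∀ s, s₁ ≤ s → 1 / 2 ≤ T' s ^ 2)
    (hnn : ∀ s, s₁ ≤ s → 0 ≤ T s) : ∀ s, s₁ ≤ s → 0 < T' s := by
  have hne : ∀ s ∈ Ici s₁, T' s ≠ 0 := fun s hs h0 ↦ by
    have := hT' s hs; rw [h0] at this; norm_num at this
  rcases hasDerivWithinAt_forall_lt_or_forall_gt_of_forall_ne (convex_Ici s₁)
    (fun s hs ↦ (hT s hs).hasDerivWithinAt) hne with hneg | hpos
  · exfalso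
    set L : ℝ := 2 * T s₁ + 2 with hL
    have hT0 := hnn s₁ le_rfl
    have hLpos : 0 < L := by linarith
    have hcont : ContinuousOn T (Icc s₁ (s₁ + L)) := fun s hs ↦
      (hT s hs.1).continuousAt.continuousWithinAt
    have hdiff : DifferentiableOn ℝ T (interior (Icc s₁ (s₁ + L))) := fun s hs ↦
      (hT s (interior_subset hs).1).differentiableAt.differentiableWithinAt
    have hle : ∀ s ∈ interior (Icc s₁ (s₁ + L)), deriv T s ≤ -(1 / 2) := by
      intro s hs
      have hs₁ : s₁ ≤ s := (interior_subset hs).1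
      rw [(hT s hs₁).deriv]
      have h1 := hneg s hs₁
      have h2 := hT' s hs₁
      nlinarith
    have h0 : s₁ ∈ Icc s₁ (s₁ + L) := ⟨le_rfl, by linarith⟩
    have h4 : s₁ + L ∈ Icc s₁ (s₁ + L) := ⟨by linarith, le_rfl⟩
    have hmv := (convex_Icc s₁ (s₁ + L)).image_sub_le_mul_sub_of_deriv_le hcont hdiff hle s₁ h0
      (s₁ + L) h4 (by linarith)
    have hend := hnn (s₁ + L) (by linarith)
    have hmv' : T (s₁ + L) - T s₁ ≤ -(1 / 2) * L := by
      have : s₁ + L - s₁ = L := by ring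
      rwa [this] at hmv
    rw [hL] at hmv'
    linarith
  · exact fun s hs ↦ hpos s hs

/-! ### Charts into a sub-development: deviation and point control -/

section Orientation

variable {U : Opens E4} {hU : IsConnected (U : Set E4)} {hsl : ∀ y : slice, sliceEmbed y ∈ U}
  {hC : (subMetric U).IsCauchyHypersurface (subOrientation U)
    (range (vacuumCauchyDevelopment.embedOpens U hsl))}

/-- The deviation of a chart into `η|_U`, unfolded: `(Ψ^* g − g₀)(x)(v, w) = η(dΨ v, dΨ w) − g₀(x)(v, w)`. -/
theorem subDev_deviation_apply {B : ModelBackground} (Ψ : B.domain → (subDev U hU hsl hC).carrier)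
    (x : B.domain) (v w : E4) :
    (subDev U hU hsl hC).toSpacetime.deviation B Ψ x v w =
      bilin (mfderiv 𝓘(ℝ, E4) (𝓡 4) Ψ x v) (mfderiv 𝓘(ℝ, E4) (𝓡 4) Ψ x w) - B.bilin x.1 v w :=
  rfl

/-- Point control from slab control: if the `Cᵏ` slab deviation at time `τ` is `< ε`, the operator norm of
the deviation is `< ε` at every point of the slab `{t = τ}` (the `m = 0` term of `supCkENorm`). -/
theorem norm_deviation_lt_of_deviationCk_lt {B : ModelBackground}
    (Ψ : B.domain → (subDev U hU hsl hC).carrier) {k : ℕ} {τ ε : ℝ} (hε : 0 < ε)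
    (h : (subDev U hU hsl hC).toSpacetime.deviationCk B Ψ k τ < ENNReal.ofReal ε) {x : B.domain}
    (hx : x ∈ B.timeSlab τ) : ‖(subDev U hU hsl hC).toSpacetime.deviation B Ψ x‖ < ε := by
  have h' : supCkENorm (Subtype.val '' B.timeSlab τ) k
      ((subDev U hU hsl hC).toSpacetime.deviationExtend B Ψ) < ENNReal.ofReal ε := h
  have h1 := enorm_iteratedFDeriv_le_supCkENorm (S := Subtype.val '' B.timeSlab τ) (k := k) (m := 0)
    (Nat.zero_le k) (x := (x : E4)) (mem_image_of_mem _ hx)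
    ((subDev U hU hsl hC).toSpacetime.deviationExtend B Ψ)
  rw [← ofReal_norm, norm_iteratedFDeriv_zero, Spacetime.deviationExtend_coe] at h1
  exact (ENNReal.ofReal_lt_ofReal_iff hε).1 (h1.trans_lt h')

/-- **Uniform timelike bound.** If the operator norm of the deviation from the flat background at `x` is
below `1/(10(‖∂₀‖² + 1))`, then `W = dΨ(∂₀)` satisfies `η(W, W) ≤ -1/2`. -/
theorem bilin_mfderiv_basisVector_le {V : Opens E4} (Ψ : (Minkowski.backgroundOn V).domain → (subDev U hU hsl hC).carrier)
    (x : (Minkowski.backgroundOn V).domain)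
    (hd : ‖(subDev U hU hsl hC).toSpacetime.deviation (Minkowski.backgroundOn V) Ψ x‖ <
      1 / (10 * (‖E4.basisVector (0 : Fin 4)‖ ^ 2 + 1))) :
    bilin (mfderiv 𝓘(ℝ, E4) (𝓡 4) Ψ x (E4.basisVector 0)) (mfderiv 𝓘(ℝ, E4) (𝓡 4) Ψ x (E4.basisVector 0))
      ≤ -(1 / 2) := by
  set u : E4 := E4.basisVector 0 with hu
  set ε : ℝ := 1 / (10 * (‖u‖ ^ 2 + 1)) with hε
  have happ : (subDev U hU hsl hC).toSpacetime.deviation (Minkowski.backgroundOn V) Ψ x u u =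
      bilin (mfderiv 𝓘(ℝ, E4) (𝓡 4) Ψ x u) (mfderiv 𝓘(ℝ, E4) (𝓡 4) Ψ x u) - bilin u u := rfl
  have hle : |(subDev U hU hsl hC).toSpacetime.deviation (Minkowski.backgroundOn V) Ψ x u u| ≤ ε * ‖u‖ ^ 2 := by
    have h1 := ((subDev U hU hsl hC).toSpacetime.deviation (Minkowski.backgroundOn V) Ψ x).le_opNorm₂ u u
    rw [Real.norm_eq_abs] at h1
    refine h1.trans ?_
    rw [pow_two, ← mul_assoc]
    gcongr
  have hεu : ε * ‖u‖ ^ 2 ≤ 1 / 10 := by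
    rw [hε, div_mul_eq_mul_div, one_mul, div_le_div_iff₀ (by positivity) (by norm_num)]
    nlinarith [sq_nonneg ‖u‖]
  have habs := (abs_le.1 (hle.trans hεu)).2
  rw [happ, hu, bilin_basisVector_zero] at habs
  rw [hu]
  linarith

/-! ### The orientation clause for the flat chart of a hole-free decomposition -/

/-- **Clause (iii) of `IsFutureOriented` is automatic.** Let `d` be a hole-free (`d.N = 0`) final-state
decomposition, in any `Cᵏ`, of a region `O ⊆ {x⁰ ≥ 0}` of the sub-development `η|_U`. Then eventually in
flat time `τ`, at every point of the flat slab `{x⁰ = τ} ∩ U₀`, the push-forward `dΨ₀(∂₀)` is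
future-directed for `(η|_U, ∂ₜ)`. -/
theorem flatChart_eventually_isFutureDirected {O : Set (subDev U hU hsl hC).carrier} {k : ℕ}
    (d : FinalStateDecomposition (subDev U hU hsl hC).toSpacetime O k) (hN : d.N = 0)
    (hO : O ⊆ (futureSet U : Set (subDev U hU hsl hC).carrier)) :
    ∀ᶠ τ in atTop, ∀ x ∈ (Minkowski.backgroundOn d.flatDomain).timeSlab τ,
      (subDev U hU hsl hC).timeOrientation.IsFutureDirected
        (mfderiv 𝓘(ℝ, E4) (𝓡 4) d.flatChart x (E4.basisVector 0)) := by
  set B : ModelBackground := Minkowski.backgroundOn d.flatDomain with hB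
  set u : E4 := E4.basisVector 0 with hu
  set ε : ℝ := 1 / (10 * (‖u‖ ^ 2 + 1)) with hε
  have hεpos : 0 < ε := by positivity
  -- Step 1: a time `τ₁ > τ₀` from which on the slab deviation is `< ε`
  have hev : ∀ᶠ τ in atTop,
      (subDev U hU hsl hC).toSpacetime.deviationCk B d.flatChart k τ < ENNReal.ofReal ε ∧ d.τ₀ < τ :=
    (d.tendsto_deviationCk_flat.eventually (gt_mem_nhds (ENNReal.ofReal_pos.2 hεpos))).and
      (eventually_gt_atTop d.τ₀)
  obtain ⟨τ₁, hτ₁⟩ := eventually_atTop.1 hev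
  -- Step 2: uniform timelike bound at every point of time `≥ τ₁`
  have htl : ∀ x : B.domain, τ₁ ≤ (x : E4) 0 →
      bilin (mfderiv 𝓘(ℝ, E4) (𝓡 4) d.flatChart x u) (mfderiv 𝓘(ℝ, E4) (𝓡 4) d.flatChart x u)
        ≤ -(1 / 2) := by
    intro x hx
    have hslab : x ∈ B.timeSlab ((x : E4) 0) := rfl
    have hd := norm_deviation_lt_of_deviationCk_lt (B := B) d.flatChart hεpos (hτ₁ _ hx).1 hslab
    exact bilin_mfderiv_basisVector_le (V := d.flatDomain) d.flatChart x hd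
  -- Step 3: the claim from time `τ₁ + 1` on
  refine eventually_atTop.2 ⟨τ₁ + 1, fun τ hτ x hx ↦ ?_⟩
  have hxtime : (x : E4) 0 = τ := hx
  -- the `x⁰`-line through `x`, parametrised by time, bent to constant time `τ₁` below `τ₁`
  set y : E3 := E4.spatial (x : E4) with hy
  have hmem : ∀ s, E4.ofTimeSpace (max s τ₁) y ∈ B.domain := fun s ↦
    d.lateRegion_subset_flatDomain_of_N_eq_zero hN
      (show d.τ₀ < (E4.ofTimeSpace (max s τ₁) y) 0 by
        rw [E4.ofTimeSpace_apply_zero]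
        exact lt_of_lt_of_le (hτ₁ τ₁ le_rfl).2 (le_max_right _ _))
  set σ : ℝ → B.domain := fun s ↦ ⟨E4.ofTimeSpace (max s τ₁) y, hmem s⟩ with hσ
  have hσ_aff : ∀ s, τ₁ < s → (σ s : E4) = E4.ofTimeSpace 0 y + s • u := fun s hs ↦ by
    change E4.ofTimeSpace (max s τ₁) y = _
    rw [max_eq_left hs.le, E4.ofTimeSpace_eq_smul_add s, add_comm]
  have hσ_time : ∀ s, τ₁ ≤ ((σ s : B.domain) : E4) 0 := fun s ↦ by
    change τ₁ ≤ (E4.ofTimeSpace (max s τ₁) y) 0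
    rw [E4.ofTimeSpace_apply_zero]
    exact le_max_right _ _
  have hστ : σ τ = x := by
    apply Subtype.ext
    change E4.ofTimeSpace (max τ τ₁) y = (x : E4)
    rw [max_eq_left (by linarith), hy, ← hxtime]
    exact E4.ofTimeSpace_time_spatial (x : E4)
  -- the image curve in coordinates, its tangent, its time coordinate
  set C : ℝ → E4 := fun s ↦ Subtype.val (d.flatChart (σ s)) with hCdef
  set W : ℝ → E4 := fun s ↦ mfderiv 𝓘(ℝ, E4) (𝓡 4) d.flatChart (σ s) u with hW
  have hderiv : ∀ s, τ₁ + 1 / 2 ≤ s → HasDerivAt C (W s) s := by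
    intro s hs
    have hs₀ : τ₁ < s := by linarith
    have hline : HasDerivAt (fun s' ↦ E4.ofTimeSpace 0 y + s' • u) u s := by
      simpa using ((hasDerivAt_id s).smul_const u).const_add (E4.ofTimeSpace 0 y)
    have hσev : (Subtype.val ∘ σ) =ᶠ[𝓝 s] fun s' ↦ E4.ofTimeSpace 0 y + s' • u := by
      filter_upwards [Ioi_mem_nhds hs₀] with s' hs'
      exact hσ_aff s' hs'
    have hσval : HasDerivAt (Subtype.val ∘ σ) u s := hline.congr_of_eventuallyEq hσev
    have hσd : MDifferentiableAt 𝓘(ℝ, ℝ) 𝓘(ℝ, E4) σ s :=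
      (mdifferentiableAt_subtypeVal_comp_curve_iff B.domain).1
        (mdifferentiableAt_iff_differentiableAt.2 hσval.differentiableAt)
    have hσvel : (velocity 𝓘(ℝ, E4) σ s : E4) = u := by
      rw [← velocity_subtypeVal_comp B.domain σ s, velocity_eq_deriv, hσval.deriv]
    have hΨd : MDifferentiableAt 𝓘(ℝ, E4) (𝓡 4) d.flatChart (σ s) :=
      (d.isLateChart_flat.contMDiff (σ s)).mdifferentiableAt (by simp)
    have hcomp : MDifferentiableAt 𝓘(ℝ, ℝ) (𝓡 4) (d.flatChart ∘ σ) s := hΨd.comp s hσd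
    have hvelcomp : (velocity (𝓡 4) (d.flatChart ∘ σ) s : E4) = W s := by
      change mfderiv 𝓘(ℝ, ℝ) (𝓡 4) (d.flatChart ∘ σ) s (1 : ℝ) = _
      rw [mfderiv_comp s hΨd hσd]
      change mfderiv 𝓘(ℝ, E4) (𝓡 4) d.flatChart (σ s) (velocity 𝓘(ℝ, E4) σ s) = _
      rw [hσvel]
    have hCd : MDifferentiableAt 𝓘(ℝ, ℝ) (𝓡 4) C s :=
      (mdifferentiableAt_subtypeVal_comp_curve_iff U).2 hcomp
    have hCd' : DifferentiableAt ℝ C s := mdifferentiableAt_iff_differentiableAt.1 hCd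
    have hCvel : (velocity (𝓡 4) C s : E4) = W s := by
      rw [← hvelcomp]
      exact velocity_subtypeVal_comp U (d.flatChart ∘ σ) s
    have hCderiv : deriv C s = W s := by rw [← hCvel]; exact (velocity_eq_deriv C s).symm
    rw [← hCderiv]
    exact hCd'.hasDerivAt
  -- the three hypotheses of the core lemma on `[τ₁ + 1/2, ∞)`
  have hT : ∀ s, τ₁ + 1 / 2 ≤ s → HasDerivAt (fun s ↦ C s 0) (W s 0) s := fun s hs ↦ by
    have h1 := ((EuclideanSpace.proj (0 : Fin 4) : E4 →L[ℝ] ℝ).hasFDerivAt.comp_hasDerivAt s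
      (hderiv s hs))
    simpa [Function.comp_def] using h1
  have hT' : ∀ s, τ₁ + 1 / 2 ≤ s → 1 / 2 ≤ W s 0 ^ 2 := fun s _ ↦
    half_le_sq_apply_zero_of_bilin_le (htl (σ s) (hσ_time s))
  have hnn : ∀ s, τ₁ + 1 / 2 ≤ s → 0 ≤ C s 0 := fun s _ ↦ by
    have hlate : σ s ∈ B.lateRegion d.τ₀ := by
      change d.τ₀ < ((σ s : B.domain) : E4) 0
      exact lt_of_lt_of_le (hτ₁ τ₁ le_rfl).2 (hσ_time s)
    exact hO (d.isLateChart_flat.image_subset (mem_image_of_mem _ hlate))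
  have hpos := deriv_pos_of_half_le_sq_deriv_of_nonneg hT hT' hnn τ (by linarith)
  -- `W τ` is the vector in question
  have hWτ : W τ = mfderiv 𝓘(ℝ, E4) (𝓡 4) d.flatChart x u := by
    change mfderiv 𝓘(ℝ, E4) (𝓡 4) d.flatChart (σ τ) u = _
    rw [hστ]
  have hbil := htl x (by linarith [hxtime])
  -- future-directed: causal, non-zero, `η(∂ₜ, W) = -W⁰ < 0`
  refine ⟨⟨?_, ?_⟩, ?_⟩
  · change bilin (mfderiv 𝓘(ℝ, E4) (𝓡 4) d.flatChart x u) (mfderiv 𝓘(ℝ, E4) (𝓡 4) d.flatChart x u) ≤ 0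
    linarith
  · intro h0
    have hz : W τ = 0 := hWτ.trans h0
    rw [hz] at hpos
    simp at hpos
  · change bilin (E4.basisVector 0) (mfderiv 𝓘(ℝ, E4) (𝓡 4) d.flatChart x u) < 0
    rw [← hWτ, bilin_basisVector_zero_left]
    linarith

/-- **The T2 orientation clause is automatic for hole-free decompositions over regions in `{x⁰ ≥ 0}`**:
`IsFutureOriented d` — the orthochronous-motion and near-zone clauses are vacuous (`Fin d.N` is empty) and
the flat clause is `flatChart_eventually_isFutureDirected`. No orientation hypothesis, no completeness of
`𝓘⁺`, no maximality is used. -/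
theorem isFutureOriented_of_N_eq_zero {O : Set (subDev U hU hsl hC).carrier} {k : ℕ}
    (d : FinalStateDecomposition (subDev U hU hsl hC).toSpacetime O k) (hN : d.N = 0)
    (hO : O ⊆ (futureSet U : Set (subDev U hU hsl hC).carrier)) :
    _root_.Summit.FinalStateConjecture.IsFutureOriented d := by
  haveI : IsEmpty (Fin d.N) := hN ▸ Fin.isEmpty'
  exact ⟨fun i ↦ isEmptyElim i, fun i ↦ isEmptyElim i, flatChart_eventually_isFutureDirected d hN hO⟩

/-- **… in particular for every HONEST hole-free decomposition** (`O = exteriorOf 𝒟 d.charted`): the honest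
region lies in `J⁺(ι X)`, whose points have `x⁰ ≥ 0` (`time_nonneg_of_mem_causalFuture_range`). This is the
form in which the clause appears in the crux and in the summit: given honesty, orientation is free. -/
theorem isFutureOriented_of_exteriorOf {O : Set (subDev U hU hsl hC).carrier} {k : ℕ}
    (d : FinalStateDecomposition (subDev U hU hsl hC).toSpacetime O k) (hN : d.N = 0)
    (hO : O = _root_.Summit.FinalStateConjecture.exteriorOf (subDev U hU hsl hC).toCauchyDevelopment d.charted) :
    _root_.Summit.FinalStateConjecture.IsFutureOriented d := by
  refine isFutureOriented_of_N_eq_zero d hN fun q hq ↦ ?_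
  rw [hO] at hq
  exact time_nonneg_of_mem_causalFuture_range (hsl := hsl) hq.1

end Orientation

end Summit.FinalStateConjecture.FinalStateConjecture.Theorems.ChannelsResolveTameDevelopmentsR.SubMinkowski

end
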